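import Literature.IUT.HodgeArakelov.MonoThetaProjective
import HarnessLib

/-!
# [IUTchII] Rmk 1.4.1 (ii), PRIMED: pointed inversion data WITHOUT the bundled uniqueness clause (U1),
# which becomes the separate named predicate `PointedInversion'.IsUniqueOuter` (G11 append-only repair, root file)

S. Mochizuki, *Inter-universal Teichmüller theory II*, §1 Remark 1.4.1 (ii), kurims manuscript (Dec. 2020) p. 28
l. 5–14 («The unique order two automorphism `ι_X̲̲` of `X̲̲_k` over `k` [cf. [EtTh], Remark 2.6.1] … corresponds at the
level of tempered fundamental groups [cf., e.g., [SemiAnbd], Theorem 6.4] to the unique order two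
`Δ^tp_{X̲̲_k}`-outer automorphism of `Π^tp_{X̲̲_k}` over `G_k`»), l. 51–56 (the lift `ι_Ÿ`, the point `(μ_-)_Ÿ`), p. 29
(`D_{μ_-}`, standard type) [cite: Mochizuki2012, Rmk 1.4.1 (ii) p.28]. Claim key `Mochizuki2012` (D-0012, DISPUTED):
definitions and `Prop`-valued statements only; nothing of the series is asserted; no side taken on [IUTchIII] Cor. 3.12.

WHY THIS FILE (abc-iut cell, layer L6; seat abc-iut-L6-t1 = typer of record of `PointedInversion`; design memo
HOME/staging/L6/L6-t1/g8/PINV-PRIME-DESIGN-MEMO.md, option (e) = G11 at the root). abc-iut-L6-t1's FROZEN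
`structure PointedInversion E D` (`MonoThetaProjective.lean`) bundles, as the FIELD `iota_unique`, print's clause (U1)
«the unique order two `Δ^tp`-outer automorphism over `G_k`». In print (U1) is a CONSEQUENCE of tempered anabelian
rigidity ([SemiAnbd] Thm. 6.4) and of `Aut(X̲̲_k) ≅ ℤ/2lℤ` — a theorem about the GENUINE `Π^tp`, not a defining datum —
and no proof in the tree uses the field except the two Prop. 2.2 (i) functoriality theorems
(`PointedInversion.exists_deltaConj_of_aut`, `…_of_pointedInversion`). At the cell's semi-synthetic Tate model the
clause is REFUTED (abc-iut-L6-d2 `ModelTateCarriers.not_huniq_modelTate`, p495619: the model's `Π^tp = ê⁻¹(ℤ) ⋊ G` is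
normal in its completion, so [SemiAnbd] Lem. 6.1 (iii) normal-terminality fails — a MODEL ARTEFACT), hence
`PointedInversion Env₀ D` is EMPTY there for every `D` (abc-iut-L6-d6 `PointedInversion.isEmpty_of_not_unique`,
p495541) although EVERY OTHER field is a theorem at the model. Rule G11 (plan/L6/ASSIGNMENTS.md §9): a
vacuous-as-typed decl is repaired APPEND-ONLY by a primed decl + a proof-only negative companion; the refuted decl
stays as a settled negative edge. THIS FILE is the primed ROOT only (no consumer is re-typed here):

* `PointedInversion' E D` — the fourteen remaining fields of `PointedInversion` VERBATIM (same names, same types);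
* `PointedInversion'.IsUniqueOuter I'` — (U1) as a separate `Prop`, the old field's statement verbatim with `I'.iota`;
* bridges `PointedInversion.toPrime`, `PointedInversion'.toPointedInversion (h : IsUniqueOuter)` (round trips are
  `rfl`), `PointedInversion.isUniqueOuter_toPrime`;
* `Rmk141_pointedInversion' E D := Nonempty (PointedInversion' E D)` with `rmk141_iff_exists_isUniqueOuter :
  Rmk141_pointedInversion E D ↔ ∃ I', I'.IsUniqueOuter` and `rmk141'_of_rmk141`.

HONEST FRAMING: `PointedInversion'` WEAKENS the typed Rmk. 1.4.1 (ii) by un-bundling (U1) — nothing is dropped from the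
tree: (U1) is `IsUniqueOuter`, and the old structure is literally `{I' // IsUniqueOuter}` up to the bridges below.
Print's second, RELATIVE uniqueness clause (U2) (`ι_Ÿ` «uniquely determined up to `l·ℤ`-conjugacy and composition with an
element `∈ Gal(Ÿ_k/Y_k)` by the condition that it fix the … orbit of `(μ_-)_Ÿ`», p. 28 l. 51–56) is, as in the frozen
structure, represented only by its existence side (`iotaYdd_lifts`, `iotaYdd_fixes`). No instance, no instance
attribute (consumers use `letI := I'.grpHDmu`), no notation; nothing landed is edited. typed ≠ proved.
-/

namespace Literature.IUT.HodgeArakelov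

universe u

variable {S : ThetaSetting.{u}}

/-- **IUTchII:Rmk1.4.1(ii), primed data type** (kurims pp. 28–29): a pointed inversion automorphism
`(ι_X̲̲; ι_Ÿ, D_{μ_-})` over `Π ≅ Π^tp_{X̲̲_k}` with its Prop. 1.2 (i) / 1.4 outputs `E`, `D` — EXACTLY the fields of
abc-iut-L6-t1's `PointedInversion E D` except the bundled uniqueness clause `iota_unique`, which is the separate
predicate `PointedInversion'.IsUniqueOuter`. «… there exists an order two automorphism `ι_Ÿ` of `Ÿ̲_k` lifting `ι_X̲̲`
… Write `D_{μ_-} ⊆ Π_{Ÿ̲_k}` for the decomposition group of `(μ_-)_Ÿ` … an étale theta function of standard type is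
defined precisely by the condition that its restriction to `D_{μ_-}` be a `2l`-th root of unity.»
[claim: Mochizuki2012, status: disputed] (IUTchII §1 Rmk 1.4.1 (ii), kurims pp.28-29) -/
structure PointedInversion' {P : TopGroup.{u}} (E : EnvOfGroup S P) (D : EtaleThetaData S P) :
    Type (u + 1) where
  /-- a representative of `ι_X̲̲`, an order-two `Δ`-outer automorphism of `Π` over `G_k` -/
  iota : P ≃ₜ* P
  /-- "over `G_k`": compatible with the quotient `Π ≅ Π_X(M^Θ(Π)) ↠ G` -/
  iota_over_G : ∀ x : P, E.recon.projG (E.isoX (iota x)) = E.recon.projG (E.isoX x)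
  /-- order two as an outer automorphism: `ι²` is inner by an element of `Δ = Ker(Π ↠ G)` -/
  iota_sq_inner : ∃ δ : P, E.recon.projG (E.isoX δ) = 1 ∧ ∀ x : P, iota (iota x) = δ * x * δ⁻¹
  /-- `ι` itself is not `Δ`-inner -/
  iota_not_inner : ¬ ∃ δ : P, E.recon.projG (E.isoX δ) = 1 ∧ ∀ x : P, iota x = δ * x * δ⁻¹
  /-- a representative of `ι_Ÿ`, an order-two (outer) automorphism of `Π_Ÿ(Π)` lifting `ι_X̲̲` -/
  iotaYdd : D.PiYdd ≃* D.PiYdd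
  iotaYdd_lifts : ∃ δ : P, E.recon.projG (E.isoX δ) = 1 ∧
    ∀ y : D.PiYdd, ((iotaYdd y : D.PiYdd) : P) = δ * iota (y : P) * δ⁻¹
  /-- `D_{μ_-} ⊆ Π_Ÿ`, the decomposition group of `(μ_-)_Ÿ` (well-defined up to `Δ^tp_Ÿ`-conjugacy) -/
  Dmu : Subgroup P
  Dmu_le : Dmu ≤ D.PiYdd
  /-- `ι_Ÿ` fixes (the conjugacy class of) `D_{μ_-}` -/
  iotaYdd_fixes : ∃ δ : D.PiYdd, E.recon.projG (E.isoX (δ : P)) = 1 ∧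
    ∀ d : P, ∀ hd : d ∈ Dmu, ((iotaYdd ⟨d, Dmu_le hd⟩ : D.PiYdd) : P) ∈
      Dmu.map (MulAut.conj (δ : P)).toMonoidHom
  /-- `H¹(D_{μ_-}, (l·Δ_Θ)(Π))` (interface, additively written) with the restriction map from
  `H¹(Π_Ÿ(Π), (l·Δ_Θ)(Π))` -/
  HDmu : Type u
  [grpHDmu : AddCommGroup HDmu]
  resDmu : D.coh.H1 ⊤ →+ HDmu
  /-- the distinguished orbit member: the class of (an `l`-th root of) THE étale theta function of standard type -/
  etaStd : D.coh.H1 ⊤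
  etaStd_mem : etaStd ∈ D.orbit
  standard : (2 * S.l) • resDmu etaStd = 0

/-! No global instance is registered for the field `PointedInversion'.grpHDmu` (typer lint rule: no instance registrations in
statement files); a consumer needing `AddCommGroup I'.HDmu` by instance search writes `letI := I'.grpHDmu`. -/

namespace PointedInversion'

variable {P : TopGroup.{u}} {E : EnvOfGroup S P} {D : EtaleThetaData S P}

/-- **(U1) as a named predicate** (kurims p. 28 l. 5–14: «the unique order two `Δ^tp_{X̲̲_k}`-outer automorphism of
`Π^tp_{X̲̲_k}` over `G_k`»): every `κ` over `G_k` which is of order two as a `Δ`-outer automorphism and not `Δ`-inner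
is `Δ`-conjugate to `I'.iota` — VERBATIM the statement of the frozen field `PointedInversion.iota_unique`. In print a
consequence of [SemiAnbd] Thm. 6.4; REFUTED at the cell's semi-synthetic Tate model (p495619, model artefact).
[claim: Mochizuki2012, status: disputed] (IUTchII §1 Rmk 1.4.1 (ii), kurims p.28) -/
def IsUniqueOuter (I' : PointedInversion' E D) : Prop :=
  ∀ κ : P ≃ₜ* P,
    (∀ x : P, E.recon.projG (E.isoX (κ x)) = E.recon.projG (E.isoX x)) →
    (∃ δ : P, E.recon.projG (E.isoX δ) = 1 ∧ ∀ x : P, κ (κ x) = δ * x * δ⁻¹) →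
    (¬ ∃ δ : P, E.recon.projG (E.isoX δ) = 1 ∧ ∀ x : P, κ x = δ * x * δ⁻¹) →
      ∃ δ : P, E.recon.projG (E.isoX δ) = 1 ∧ ∀ x : P, κ x = δ * I'.iota x * δ⁻¹

/-- **Bridge back to the frozen type**: primed data satisfying (U1) IS a `PointedInversion` (all fields carried
verbatim, `iota_unique := h`). [claim: Mochizuki2012, status: disputed] (IUTchII §1 Rmk 1.4.1 (ii), kurims p.28) -/
def toPointedInversion (I' : PointedInversion' E D) (h : I'.IsUniqueOuter) : PointedInversion E D where
  iota := I'.iota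
  iota_over_G := I'.iota_over_G
  iota_sq_inner := I'.iota_sq_inner
  iota_not_inner := I'.iota_not_inner
  iota_unique := h
  iotaYdd := I'.iotaYdd
  iotaYdd_lifts := I'.iotaYdd_lifts
  Dmu := I'.Dmu
  Dmu_le := I'.Dmu_le
  iotaYdd_fixes := I'.iotaYdd_fixes
  HDmu := I'.HDmu
  grpHDmu := I'.grpHDmu
  resDmu := I'.resDmu
  etaStd := I'.etaStd
  etaStd_mem := I'.etaStd_mem
  standard := I'.standard

/-- `IsUniqueOuter` depends on `I'` only through `I'.iota`: two primed data with the same `ι` have the same (U1).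
[claim: Mochizuki2012, status: disputed] (IUTchII §1 Rmk 1.4.1 (ii), kurims p.28) -/
theorem isUniqueOuter_congr_iota {I₁ I₂ : PointedInversion' E D} (h : I₁.iota = I₂.iota) :
    I₁.IsUniqueOuter ↔ I₂.IsUniqueOuter := by
  unfold IsUniqueOuter
  rw [h]

end PointedInversion'

namespace PointedInversion

variable {P : TopGroup.{u}} {E : EnvOfGroup S P} {D : EtaleThetaData S P}

/-- **Forgetful bridge**: a `PointedInversion` yields primed data (drop the field `iota_unique`).
[claim: Mochizuki2012, status: disputed] (IUTchII §1 Rmk 1.4.1 (ii), kurims p.28) -/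
def toPrime (I : PointedInversion E D) : PointedInversion' E D where
  iota := I.iota
  iota_over_G := I.iota_over_G
  iota_sq_inner := I.iota_sq_inner
  iota_not_inner := I.iota_not_inner
  iotaYdd := I.iotaYdd
  iotaYdd_lifts := I.iotaYdd_lifts
  Dmu := I.Dmu
  Dmu_le := I.Dmu_le
  iotaYdd_fixes := I.iotaYdd_fixes
  HDmu := I.HDmu
  grpHDmu := I.grpHDmu
  resDmu := I.resDmu
  etaStd := I.etaStd
  etaStd_mem := I.etaStd_mem
  standard := I.standard

/-- The forgotten field IS (U1) of the primed data. [claim: Mochizuki2012, status: disputed] (IUTchII §1 Rmk 1.4.1 (ii), kurims p.28) -/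
theorem isUniqueOuter_toPrime (I : PointedInversion E D) : I.toPrime.IsUniqueOuter :=
  I.iota_unique

/-- Round trip `PointedInversion → PointedInversion' → PointedInversion` is the identity.
[claim: Mochizuki2012, status: disputed] (IUTchII §1 Rmk 1.4.1 (ii), kurims p.28) -/
theorem toPointedInversion_toPrime (I : PointedInversion E D) :
    I.toPrime.toPointedInversion I.isUniqueOuter_toPrime = I := rfl

/-- `toPrime` forgets nothing but (U1): it is injective. [claim: Mochizuki2012, status: disputed] (IUTchII §1 Rmk 1.4.1 (ii), kurims p.28) -/
theorem toPrime_injective : Function.Injective (toPrime : PointedInversion E D → PointedInversion' E D) := by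
  intro I₁ I₂ h
  rw [← toPointedInversion_toPrime I₁, ← toPointedInversion_toPrime I₂]
  congr 1

end PointedInversion

namespace PointedInversion'

variable {P : TopGroup.{u}} {E : EnvOfGroup S P} {D : EtaleThetaData S P}

/-- Round trip `PointedInversion' → PointedInversion → PointedInversion'` is the identity.
[claim: Mochizuki2012, status: disputed] (IUTchII §1 Rmk 1.4.1 (ii), kurims p.28) -/
theorem toPrime_toPointedInversion (I' : PointedInversion' E D) (h : I'.IsUniqueOuter) :
    (I'.toPointedInversion h).toPrime = I' := rfl

/-- The frozen type is EXACTLY the primed type cut out by (U1): `PointedInversion E D ≃ {I' // I'.IsUniqueOuter}`.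
[claim: Mochizuki2012, status: disputed] (IUTchII §1 Rmk 1.4.1 (ii), kurims p.28) -/
def equivSubtype : PointedInversion E D ≃ {I' : PointedInversion' E D // I'.IsUniqueOuter} where
  toFun I := ⟨I.toPrime, I.isUniqueOuter_toPrime⟩
  invFun I' := I'.1.toPointedInversion I'.2
  left_inv I := PointedInversion.toPointedInversion_toPrime I
  right_inv I' := Subtype.ext (toPrime_toPointedInversion I'.1 I'.2)

end PointedInversion'

/-- **IUTchII:Rmk1.4.1(ii) existence clause, primed** (kurims p. 28: «there exists an order two automorphism `ι_Ÿ`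
of `Ÿ̲_k` lifting `ι_X̲̲` …»): pointed-inversion DATA exist over `(E, D)` — (U1) NOT included. PREDICATE on the outputs.
[claim: Mochizuki2012, status: disputed] (IUTchII §1 Rmk 1.4.1 (ii), kurims p.28) -/
def Rmk141_pointedInversion' {P : TopGroup.{u}} (E : EnvOfGroup S P) (D : EtaleThetaData S P) : Prop :=
  Nonempty (PointedInversion' E D)

section Rmk141

variable {P : TopGroup.{u}} {E : EnvOfGroup S P} {D : EtaleThetaData S P}

/-- The frozen existence clause implies the primed one. [claim: Mochizuki2012, status: disputed] (IUTchII §1 Rmk 1.4.1 (ii), kurims p.28) -/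
theorem rmk141'_of_rmk141 (h : Rmk141_pointedInversion E D) : Rmk141_pointedInversion' E D :=
  h.map PointedInversion.toPrime

/-- The frozen existence clause = primed existence + (U1) for some primed datum.
[claim: Mochizuki2012, status: disputed] (IUTchII §1 Rmk 1.4.1 (ii), kurims p.28) -/
theorem rmk141_iff_exists_isUniqueOuter :
    Rmk141_pointedInversion E D ↔ ∃ I' : PointedInversion' E D, I'.IsUniqueOuter :=
  ⟨fun ⟨I⟩ => ⟨I.toPrime, I.isUniqueOuter_toPrime⟩, fun ⟨I', h⟩ => ⟨I'.toPointedInversion h⟩⟩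

/-- Contrapositive form used at the model: primed data exist but NONE satisfies (U1) ⇒ the frozen type is empty while
the primed existence clause holds (the G11 «settled negative edge» next to its primed repair).
[claim: Mochizuki2012, status: disputed] (IUTchII §1 Rmk 1.4.1 (ii), kurims p.28) -/
theorem rmk141'_and_not_rmk141_of_forall_not_isUniqueOuter (I' : PointedInversion' E D)
    (h : ∀ J : PointedInversion' E D, ¬ J.IsUniqueOuter) :
    Rmk141_pointedInversion' E D ∧ ¬ Rmk141_pointedInversion E D :=
  ⟨⟨I'⟩, fun ⟨I⟩ => h I.toPrime I.isUniqueOuter_toPrime⟩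

end Rmk141

end Literature.IUT.HodgeArakelov
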